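import Summits.QuantumFields.BalabanUV.Beta.D1BFx.CoarseGramInverse
import Summits.QuantumFields.BalabanUV.Beta.D1BFx.TorusCombKKT
import Summits.QuantumFields.BalabanUV.Beta.D1BFx.BorderedInverseMassive
import Summits.QuantumFields.BalabanUV.Beta.D1BFx.VectorLegKernelForm

/-!
# `BalabanUV.Beta.D1BFx.TorusBorderedResolvent` — road «BF-x» for binder row D1, slot (K), `K-ASSEMBLY-SPEC-v2.md` §1 brick 3c (part 1):
# **THE INVERSE OF THE R-WEIGHTED BORDERED SYSTEM `N_T` ON EVERY COARSE TORUS**, assembled from the torus massive propagator `Ĝ` (the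
# periodised gluon leg), leaf-03's torus averaging matrix `Q̂ = TorusCombKKT.Qhat` and the torus coarse-Gram inverse `Ĉ` (`CoarseGramInverse`),
# by finite Woodbury (`BorderedInverseMassive.kkt_inv_eq_massiveBlocks`) — MODULO the two torus letters of bricks 3b-R ∕ 3b-Q, DISPLAYED BY SHAPE

HONEST FRAMING (cell contract, verbatim): «discharging `BetaPertH` makes Bałaban's UV stability UNCONDITIONAL — a real constructive-QFT
result; it is NOT the continuum limit and NOT the Clay problem.»  HONEST DEPENDENCY (verbatim): «continuum YM on T⁴ ⇐ BetaPertH ∧ nine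
spine estimates (0/9 proved); BetaPertH ⇐ (D1) ∧ (D4) ∧ CAP+tail; G-an2-4 gates asym, D1 and NE2/3/4.»  THIS MODULE DISCHARGES NOTHING of
D1 / BetaPertH: finite-dimensional linear algebra over the tree's `Composition.kkt`, this lineage's `BorderedInverseMassive` (p236476) and
`CoarseGramInverse` (p238151), leaf-03-g8's `TorusCombKKT` (`I`, `J`, `Qhat`), TA1's `SortedReblocking.reblock`, `FibredPeriodisation.periodiseF`,
`PeriodicArrays.toF`, `VectorLegKernelForm.X1aKer` and `GluonLeg.Ga` BY NAME.  Five [our object] data `def`s with bodies (`X1aM`, `Xhat`, `Ghat`,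
`Chat`, `NT`); no `def … : Prop`; nothing is cited; 0 sorry.  The two torus letters `hXG` (brick 3b-R: `X̂(a∕n⁸)·Ĝ = 1`, the sorted-currency
transport of `VectorPropagatorImages.periodiseF_X1aKer_mul_GaF`) and `hlin` ∕ `hgram` (brick 3b-Q: `X̂(a′) = X̂(0) + a′•Q̂ᵀQ̂`,
`Q̂·Ĝ·Q̂ᵀ = (toF (gramM …))^`) are DISPLAYED HYPOTHESES stated by shape (K-ASSEMBLY-SPEC-v2 §1); the decay `Spr (Ga (m+1) a)` is displayed as
everywhere on the road.  NOT summit progress; NOT BetaPertH, NOT continuum, NOT Clay.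

ABSOLUTE RULE (cell, verbatim): «No internally-minted statement may enter as a cited fact. Every hypothesis is either kernel-proved in this
package or a verbatim quotation of a PUBLISHED theorem with page reference. The manuscript(s) under audit are NOT citable for their own
disputed steps — they are the thing under adjudication; programme-internal (2001/route/tribunal) claims are never citable.»

WHY (`HOME/b2b-balaban-beta-d1-p2/K-ASSEMBLY-SPEC-v2.md` §0 DECISION 1–2, §1 brick 3c).  In the sorted currency over the coarse torus
`Site 4 p` (`ν = I 3 n p` fine bonds re-blocked, `μ = J 3 p` coarse bonds, `n = m+1`) the M-side of the slice-transfer identity is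
`kkt Khat [Qhat; τ_T]` (TB1, `TorusCombKKT`), with `Khat = (curvAdj∘curv)^ = (2·δd)^`.  The road's leg `Ga` inverts `½S + dRδ + (a∕n⁸)𝒬ᵀ𝒬`
(X₁a), so the N-side fine operator `K₀ + B₀` of the identity is `2·X̂(0) = (S + 2dRδ)^` and the N-system is `N_T := kkt (2•X̂(0)) Q̂`.  Finite
Woodbury with `G := ½Ĝ` (mass `2a∕n⁸`) and `C := 2Ĉ` inverts it, GIVEN the two torus letters; the blocks come out as
`[[½(Ĝ − ĜQ̂ᵀĈQ̂Ĝ), ĜQ̂ᵀĈ],[ĈQ̂Ĝ, (2a∕n⁸)·1 − 2Ĉ]]` = the torus form of the pack `(½Γ_R, ℋ_R, ℋ♭_R, 2((a∕n⁸)δ − Cun′))` (brick 3b-P ∕ 3c part 2).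

CONTENT (`m`, `a`, coarse period `p`; all [folklore] / [our object]).
* §1 objects: `X1aM n a a′` (X₁a's kernel as an `MKer`; `toF_X1aM`), `Xhat m a a′ p := (reblock (m+1) (X1aM (m+1) a a′))^`, `Ghat m a p := (reblock (m+1) (Ga (m+1) a))^`,
  `Chat m a p := (toF (multM (m+1) (2a∕(m+1)⁸) 2))^` (= `((m+1)⁻⁸·Cun (m+1) a)^`), `NT m a p := kkt (2 • Xhat m a 0 p) (Qhat (m+1) p)`.
* §2 the Woodbury hypotheses from the letters: `weighted_mul_half_Ghat` (`(2X̂₀ + (2a∕n⁸)Q̂ᵀQ̂)·(½Ĝ) = 1` ⟸ `hXG`, `hlin`), `coarse_mul_two_Chat`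
  (`(Q̂(½Ĝ)Q̂ᵀ)·(2Ĉ) = 1` ⟸ `hgram` + `CoarseGramInverse.gram_torus_inverse_Ga`, modulo `Spr Ga`).
* §3 **`NT_mul_massiveBlocks`**, **`isUnit_det_NT`**, **`inv_NT_eq_massiveBlocks`** (`N_T⁻¹ = massiveBlocks (½Ĝ) Q̂ (2Ĉ) (2a∕n⁸)`), and the explicit
  block form **`inv_NT_eq_fromBlocks`** (`N_T⁻¹ = fromBlocks (½(Ĝ − ĜQ̂ᵀĈQ̂Ĝ)) (ĜQ̂ᵀĈ) (ĈQ̂Ĝ) ((2a∕n⁸)•1 − 2Ĉ)`).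
NOT HERE: the letters themselves (3b-R, 3b-Q), the packed `ℤ⁴` N-leg and `N_T⁻¹ = blocksHat p (sortK n NlegK)` (3b-P ∕ 3c part 2), TB3–TB5.
Unit `b2b-balaban-beta-d1-p2` (road owner, gen 6).
-/

noncomputable section

namespace Summit.QuantumFields.BalabanUV.Beta.D1BFx.TorusBorderedResolvent

open Matrix
open scoped BigOperators
open Literature.MathematicalPhysics.QuantumFieldTheory.Balaban1983to89
open Literature.MathematicalPhysics.QuantumFieldTheory.Balaban1983to89.Beta
open Literature.MathematicalPhysics.QuantumFieldTheory.Balaban1983to89.Beta.Composition (kkt)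
open ExpKernelCalculus (MKer)
open Summit.QuantumFields.BalabanUV.Beta.TameKernelCalculus (Spr)
open Summit.QuantumFields.BalabanUV.Beta.D1BFx.FibredPeriodisation (FKer periodiseF)
open Summit.QuantumFields.BalabanUV.Beta.D1BFx.PeriodicArrays (toF)
open Summit.QuantumFields.BalabanUV.Beta.D1BFx.SortedReblocking (reblock)
open Summit.QuantumFields.BalabanUV.Beta.D1BFx.TorusCombKKT (I J Qhat)
open Summit.QuantumFields.BalabanUV.Beta.D1BFx.BorderedInverseMassive (massiveBlocks kkt_mul_massiveBlocks kkt_inv_eq_massiveBlocks)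
open Summit.QuantumFields.BalabanUV.Beta.D1BFx.VectorLegKernelForm (X1aKer)
open Summit.QuantumFields.BalabanUV.Beta.D1BFx.CoarseGramInverse (gramM multM gram_torus_inverse_Ga)
open Summit.QuantumFields.BalabanUV.Beta.D1BFx.GluonLeg (Ga)

/-! ## §1 The torus objects of the N-side (sorted currency over the coarse torus `Site 4 p`) -/

/-- [our object] X₁a's fibred kernel `X1aKer n a a′` read as an `MKer 4 (Fin 4)` (so that TA1's `reblock` applies): `X1aM n a a′ x w κ l := X1aKer n a a′ (x,κ) (w,l)`. -/
def X1aM (n : ℕ) [NeZero n] (a a' : ℝ) : MKer 4 (Fin 4) := fun x w κ l => X1aKer n a a' (x, κ) (w, l)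

/-- [our object] `toF` undoes the reading: `toF (X1aM n a a′) = X1aKer n a a′`. -/
theorem toF_X1aM (n : ℕ) [NeZero n] (a a' : ℝ) : toF (X1aM n a a') = X1aKer n a a' := rfl

variable (m : ℕ) (a : ℝ) (p : ℕ) [NeZero p]

/-- [our object] **`X̂(a′)`** — the torus matrix (fine bonds re-blocked over the coarse torus) of X₁a's operator `½S + dRδ + a′𝒬ᵀ𝒬` at block side `m+1`. -/
def Xhat (a' : ℝ) : Matrix (I 3 (m + 1) p) (I 3 (m + 1) p) ℝ := Matrix.of (periodiseF p (reblock (m + 1) (X1aM (m + 1) a a')))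

/-- [our object] **`Ĝ`** — the torus matrix of the gluon leg `Ga (m+1) a` (= `(m+1)²·Re calG_T` in fine-torus currency, `VectorPropagatorImages`). -/
def Ghat : Matrix (I 3 (m + 1) p) (I 3 (m + 1) p) ℝ := Matrix.of (periodiseF p (reblock (m + 1) (Ga (m + 1) a)))

/-- [our object] **`Ĉ`** — the torus matrix of the road's shifted constraint multiplier `multM (m+1) (2a∕(m+1)⁸) 2 = (m+1)⁻⁸·Cun (m+1) a`
(`CoarseGramInverse.multM_road_eq_Cun`): the inverse of the torus coarse Gram `(𝒬Ga𝒬ᵀ)^` (`gram_torus_inverse_Ga`). -/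
def Chat : Matrix (J 3 p) (J 3 p) ℝ := Matrix.of (periodiseF p (toF (multM (m + 1) (2 * a / ((m + 1 : ℕ) : ℝ) ^ 8) 2)))

/-- [our object] **`N_T`** — THE R-WEIGHTED BORDERED SYSTEM of the slice-transfer identity on the coarse torus: `kkt (2•X̂(0)) Q̂`
(fine operator `S + 2dRδ`, sharp averaging constraint `Q̂ = TorusCombKKT.Qhat`). -/
def NT : Matrix (I 3 (m + 1) p ⊕ J 3 p) (I 3 (m + 1) p ⊕ J 3 p) ℝ := kkt ((2 : ℝ) • Xhat m a p 0) (Qhat (d := 3) (m + 1) p)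

/-- [our object] Unfolding `NT`. -/
theorem NT_eq : NT m a p = kkt ((2 : ℝ) • Xhat m a p 0) (Qhat (d := 3) (m + 1) p) := rfl

/-! ## §2 The two Woodbury hypotheses from the torus letters -/

section Woodbury

variable {m a p}

/-- [folklore] **THE MASSIVE RESOLVENT HYPOTHESIS**: from the letters `hXG : X̂(a∕n⁸)·Ĝ = 1` (brick 3b-R) and `hlin : X̂(a∕n⁸) = X̂(0) + (a∕n⁸)•Q̂ᵀQ̂`
(brick 3b-Q (i)), `(2•X̂(0) + (2a∕n⁸)•(Q̂ᵀQ̂)) · (½•Ĝ) = 1` — the `hG` of `kkt_inv_eq_massiveBlocks` for `K := 2•X̂(0)`, mass `2a∕n⁸`, `G := ½•Ĝ`. -/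
theorem weighted_mul_half_Ghat
    (hXG : Xhat m a p (a / ((m + 1 : ℕ) : ℝ) ^ 8) * Ghat m a p = 1)
    (hlin : Xhat m a p (a / ((m + 1 : ℕ) : ℝ) ^ 8)
      = Xhat m a p 0 + (a / ((m + 1 : ℕ) : ℝ) ^ 8) • ((Qhat (d := 3) (m + 1) p)ᵀ * Qhat (d := 3) (m + 1) p)) :
    ((2 : ℝ) • Xhat m a p 0 + (2 * a / ((m + 1 : ℕ) : ℝ) ^ 8) • ((Qhat (d := 3) (m + 1) p)ᵀ * Qhat (d := 3) (m + 1) p))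
        * ((1 / 2 : ℝ) • Ghat m a p) = 1 := by
  have e : (2 : ℝ) • Xhat m a p 0 + (2 * a / ((m + 1 : ℕ) : ℝ) ^ 8) • ((Qhat (d := 3) (m + 1) p)ᵀ * Qhat (d := 3) (m + 1) p)
      = (2 : ℝ) • Xhat m a p (a / ((m + 1 : ℕ) : ℝ) ^ 8) := by
    rw [hlin, smul_add, smul_smul]
    congr 2
    ring
  rw [e, Matrix.smul_mul, Matrix.mul_smul, hXG, smul_smul]
  norm_num

/-- [folklore] **THE COARSE INVERSE HYPOTHESIS**: from the letter `hgram : Q̂·Ĝ·Q̂ᵀ = (toF (gramM (m+1) (Ga (m+1) a)))^` (brick 3b-Q (ii)) and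
`CoarseGramInverse.gram_torus_inverse_Ga` (modulo `Spr (Ga (m+1) a)`), `(Q̂·(½•Ĝ)·Q̂ᵀ) · (2•Ĉ) = 1` — the `hC` of `kkt_inv_eq_massiveBlocks`. -/
theorem coarse_mul_two_Chat (ha : 0 < a) (hGa : Spr (Ga (m + 1) a))
    (hgram : Qhat (d := 3) (m + 1) p * Ghat m a p * (Qhat (d := 3) (m + 1) p)ᵀ
      = Matrix.of (periodiseF p (toF (gramM (m + 1) (Ga (m + 1) a))))) :
    (Qhat (d := 3) (m + 1) p * ((1 / 2 : ℝ) • Ghat m a p) * (Qhat (d := 3) (m + 1) p)ᵀ) * ((2 : ℝ) • Chat m a p) = 1 := by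
  have h1 := (gram_torus_inverse_Ga m p ha hGa).1
  have e : Qhat (d := 3) (m + 1) p * ((1 / 2 : ℝ) • Ghat m a p) * (Qhat (d := 3) (m + 1) p)ᵀ * ((2 : ℝ) • Chat m a p)
      = Qhat (d := 3) (m + 1) p * Ghat m a p * (Qhat (d := 3) (m + 1) p)ᵀ * Chat m a p := by
    simp only [Matrix.mul_smul, Matrix.smul_mul, smul_smul]
    norm_num
  rw [e, hgram, Chat]
  exact h1

end Woodbury

/-! ## §3 The inverse of `N_T` -/

section Inverse

variable {m a p}

/-- [folklore] **`N_T · massiveBlocks (½Ĝ) Q̂ (2Ĉ) (2a∕n⁸) = 1`** modulo the torus letters `hXG`, `hlin`, `hgram` and `Spr (Ga (m+1) a)`. -/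
theorem NT_mul_massiveBlocks (ha : 0 < a) (hGa : Spr (Ga (m + 1) a))
    (hXG : Xhat m a p (a / ((m + 1 : ℕ) : ℝ) ^ 8) * Ghat m a p = 1)
    (hlin : Xhat m a p (a / ((m + 1 : ℕ) : ℝ) ^ 8)
      = Xhat m a p 0 + (a / ((m + 1 : ℕ) : ℝ) ^ 8) • ((Qhat (d := 3) (m + 1) p)ᵀ * Qhat (d := 3) (m + 1) p))
    (hgram : Qhat (d := 3) (m + 1) p * Ghat m a p * (Qhat (d := 3) (m + 1) p)ᵀ
      = Matrix.of (periodiseF p (toF (gramM (m + 1) (Ga (m + 1) a))))) :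
    NT m a p * massiveBlocks ((1 / 2 : ℝ) • Ghat m a p) (Qhat (d := 3) (m + 1) p) ((2 : ℝ) • Chat m a p)
        (2 * a / ((m + 1 : ℕ) : ℝ) ^ 8) = 1 :=
  kkt_mul_massiveBlocks _ _ _ _ _ (weighted_mul_half_Ghat hXG hlin) (coarse_mul_two_Chat ha hGa hgram)

/-- [folklore] **`N_T` IS INVERTIBLE** (modulo the torus letters and `Spr (Ga (m+1) a)`): the `hN`-type nondegeneracy the slice-transfer identity needs
on the R-weighted side. -/
theorem isUnit_det_NT (ha : 0 < a) (hGa : Spr (Ga (m + 1) a))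
    (hXG : Xhat m a p (a / ((m + 1 : ℕ) : ℝ) ^ 8) * Ghat m a p = 1)
    (hlin : Xhat m a p (a / ((m + 1 : ℕ) : ℝ) ^ 8)
      = Xhat m a p 0 + (a / ((m + 1 : ℕ) : ℝ) ^ 8) • ((Qhat (d := 3) (m + 1) p)ᵀ * Qhat (d := 3) (m + 1) p))
    (hgram : Qhat (d := 3) (m + 1) p * Ghat m a p * (Qhat (d := 3) (m + 1) p)ᵀ
      = Matrix.of (periodiseF p (toF (gramM (m + 1) (Ga (m + 1) a))))) :
    IsUnit (NT m a p).det :=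
  Matrix.isUnit_det_of_right_inverse (NT_mul_massiveBlocks ha hGa hXG hlin hgram)

/-- [folklore] **THE INVERSE OF THE R-WEIGHTED BORDERED SYSTEM ON THE TORUS**: `N_T⁻¹ = massiveBlocks (½Ĝ) Q̂ (2Ĉ) (2a∕n⁸)`
(modulo the torus letters and `Spr (Ga (m+1) a)`). -/
theorem inv_NT_eq_massiveBlocks (ha : 0 < a) (hGa : Spr (Ga (m + 1) a))
    (hXG : Xhat m a p (a / ((m + 1 : ℕ) : ℝ) ^ 8) * Ghat m a p = 1)
    (hlin : Xhat m a p (a / ((m + 1 : ℕ) : ℝ) ^ 8)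
      = Xhat m a p 0 + (a / ((m + 1 : ℕ) : ℝ) ^ 8) • ((Qhat (d := 3) (m + 1) p)ᵀ * Qhat (d := 3) (m + 1) p))
    (hgram : Qhat (d := 3) (m + 1) p * Ghat m a p * (Qhat (d := 3) (m + 1) p)ᵀ
      = Matrix.of (periodiseF p (toF (gramM (m + 1) (Ga (m + 1) a))))) :
    (NT m a p)⁻¹ = massiveBlocks ((1 / 2 : ℝ) • Ghat m a p) (Qhat (d := 3) (m + 1) p) ((2 : ℝ) • Chat m a p)
        (2 * a / ((m + 1 : ℕ) : ℝ) ^ 8) :=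
  kkt_inv_eq_massiveBlocks _ _ _ _ _ (weighted_mul_half_Ghat hXG hlin) (coarse_mul_two_Chat ha hGa hgram)

/-- [folklore] **THE BLOCKS OF `N_T⁻¹`, EXPLICITLY**: `N_T⁻¹ = [[½(Ĝ − ĜQ̂ᵀĈQ̂Ĝ), ĜQ̂ᵀĈ],[ĈQ̂Ĝ, (2a∕n⁸)·1 − 2Ĉ]]` — the torus form of the pack
`(½Γ_R, ℋ_R, ℋ♭_R, 2((a∕n⁸)δ − Cun′))` of K-R1-SPEC v2 §3 (modulo the torus letters and `Spr (Ga (m+1) a)`). -/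
theorem inv_NT_eq_fromBlocks (ha : 0 < a) (hGa : Spr (Ga (m + 1) a))
    (hXG : Xhat m a p (a / ((m + 1 : ℕ) : ℝ) ^ 8) * Ghat m a p = 1)
    (hlin : Xhat m a p (a / ((m + 1 : ℕ) : ℝ) ^ 8)
      = Xhat m a p 0 + (a / ((m + 1 : ℕ) : ℝ) ^ 8) • ((Qhat (d := 3) (m + 1) p)ᵀ * Qhat (d := 3) (m + 1) p))
    (hgram : Qhat (d := 3) (m + 1) p * Ghat m a p * (Qhat (d := 3) (m + 1) p)ᵀ
      = Matrix.of (periodiseF p (toF (gramM (m + 1) (Ga (m + 1) a))))) :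
    (NT m a p)⁻¹
      = Matrix.fromBlocks
          ((1 / 2 : ℝ) • (Ghat m a p - Ghat m a p * (Qhat (d := 3) (m + 1) p)ᵀ * Chat m a p * Qhat (d := 3) (m + 1) p * Ghat m a p))
          (Ghat m a p * (Qhat (d := 3) (m + 1) p)ᵀ * Chat m a p)
          (Chat m a p * Qhat (d := 3) (m + 1) p * Ghat m a p)
          ((2 * a / ((m + 1 : ℕ) : ℝ) ^ 8) • (1 : Matrix (J 3 p) (J 3 p) ℝ) - (2 : ℝ) • Chat m a p) := by
  rw [inv_NT_eq_massiveBlocks ha hGa hXG hlin hgram, massiveBlocks]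
  congr 1
  · simp only [Matrix.smul_mul, Matrix.mul_smul, smul_sub, smul_smul]
    norm_num
  · simp only [Matrix.smul_mul, Matrix.mul_smul, smul_smul]
    norm_num
  · simp only [Matrix.smul_mul, Matrix.mul_smul, smul_smul]
    norm_num

end Inverse

end Summit.QuantumFields.BalabanUV.Beta.D1BFx.TorusBorderedResolvent

end
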